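import Summits.NavierStokesRegularity.FluidComputer.ClayBlowupLocalZoomResidualTools
import Summits.NavierStokesRegularity.FluidComputer.ClayBlowupZoomTools
import Literature.Analysis.FluidPDE.ClassicalSolutionRescale
import HarnessLib

/-!
# THE TRUNCATED ZOOM OF A CLAY BLOW-UP WITH FORCE, FREE AMPLITUDE RATIO `Λ`

Cell `ns-blowup`, seat `ns-blowup-ecbridge-2` (g12; the E–C endpoint theory seat). LABEL: E–C typing
(KERNEL — no named fact, no new definition). WHAT THIS IS NOT: not Navier–Stokes evidence — a priori
bounds for a rescaled, truncated copy of the velocity of the TYPE `ClayBlowup 1`; no inhabitant is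
claimed. Companion memo: `run/shared/lean/pub/ns-blowup/ecbridge2/ECBRIDGE-2-MEMO-11.md`.

g11's `ClayBlowup.exists_local_zoom_residual_bounds` ties the zoom scale `M` to the amplitude bound
`‖u‖ ≤ 4M` on the whole backward window. In the geometry of KNSS 2009 Thm 6.2 (zoom at a running
maximum of `|x'|‖u‖`, arXiv p. 13) the zoom is bounded near the receding axis only by the Type-I
profile `C/√(−τ)`, so the ratio amplitude/scale must be a FREE parameter `Λ ≥ 4`, window by window.
`ClayBlowup.exists_local_zoom_residual_bounds_lambda` re-runs g11's proof with that one change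
(constants first `P, Q ≥ 0` of `X`; bounds × `Λ²`; `Θ = 1/R + 1/R² + (1 + M)/R⁴ + M⁻¹`): for
`−(τ₀ − t_b)M² < s < t ≤ 0`, (i) IF `‖u‖ ≤ ΛM` on `[τ₀ + M⁻²s, τ₀ + M⁻²t] × B(y₀, R/M)` and
`t − s ≤ 1`: `‖w̃(t) − e^{(t−s)Δ}w̃(s) + B¹_s(w̃,w̃)(t)‖(z) ≤ Λ²(P + QΘ)√(t − s)` at every `z`;
(ii) IF `‖u(τ₀ + M⁻²s)‖ ≤ ΛM` on `B(y₀, R/M)` AT THE BASE TIME ONLY: the same is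
`≤ Λ²QΘ(√(t − s) + (t − s))` for every lag and `‖z‖ ≤ R/4` — the form the VERTEX step of a blow-up
argument needs (base `−1`, tops up to `0`, no amplitude bound uniform up to the top).

References: Koch–Nadirashvili–Seregin–Šverák, Acta Math. 203 (2009), §6 (6.2)–(6.3), Lemma 6.1, proof
of Thm 6.2 [cite: KochNadirashviliSereginSverak2009, §6 (arXiv pp. 11–13)]; Koch–Tataru, Adv. Math.
157 (2001), (14) [cite: KochTataruAdvMath2001, §3 (14)].
-/
noncomputable section

namespace Summit.NavierStokesRegularity.FluidComputer

open Set MeasureTheory Filter Topology Function Metric Real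
open scoped ENNReal NNReal
open Literature.Analysis Literature.Analysis.FluidPDE
open Summit.NavierStokesRegularity.NavierStokesRegularity

namespace ClayBlowup
set_option maxHeartbeats 800000 in
-- one long bookkeeping proof: four estimates assembled at every point, twice (g11's proof with a free ratio)
/-- **PERTURBATION BOUNDS FOR THE TRUNCATED LOCAL ZOOM, FREE AMPLITUDE RATIO, CONSTANTS FIRST** (no
named fact): `P, Q ≥ 0` depend only on `X : ClayBlowup 1`; for every centre `(τ₀, y₀)`, `τ₀ < T`, base
`0 ≤ t_b < τ₀`, scale `M ≥ 1`, radius `R > 0`, g11-cutoff `χ` of `B(0, R)` and ratio `Λ ≥ 4`, with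
`w = M⁻¹ • stPull M⁻² M⁻¹ τ₀ y₀ u`, `w̃ = χ • w`, for all `−(τ₀ − t_b) M² < s < t ≤ 0`: (i) the window
bound `‖u‖ ≤ ΛM` on `[τ₀ + M⁻²s, τ₀ + M⁻²t] × B(y₀, R/M)` and `t − s ≤ 1` give
`‖w̃(t,z) − e^{(t−s)Δ}w̃(s)(z) + B¹_s(w̃,w̃)(t)(z)‖ ≤ Λ²(P + QΘ)√(t − s)` for every `z`; (ii) the
base-time bound `‖u(τ₀ + M⁻²s, ·)‖ ≤ ΛM` on `B(y₀, R/M)` gives `≤ Λ²QΘ(√(t − s) + (t − s))` for every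
lag and `‖z‖ ≤ R/4`. [cite: KochNadirashviliSereginSverak2009, §6 (6.2)–(6.3), Lemma 6.1 and proof of Thm 6.2 (arXiv pp. 11–13)]
[cite: KochTataruAdvMath2001, §3 (14)] -/
theorem exists_local_zoom_residual_bounds_lambda (X : ClayBlowup 1) :
    ∃ P Q : ℝ, 0 ≤ P ∧ 0 ≤ Q ∧ ∀ {τ₀ t_b M R Λ : ℝ} {y₀ : EuclideanSpace ℝ (Fin 3)}
      {χ : EuclideanSpace ℝ (Fin 3) → ℝ}, τ₀ < X.T → 0 ≤ t_b → t_b < τ₀ → 1 ≤ M → 0 < R → 4 ≤ Λ →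
      (∀ y, 0 ≤ χ y ∧ χ y ≤ 1) → (∀ y, ‖y‖ ≤ R / 2 → χ y = 1) → (∀ y, 3 * R / 4 ≤ ‖y‖ → χ y = 0) →
      (∀ y z, |χ y - χ z| ≤ 4 / R * ‖y - z‖) → Continuous χ → ∀ s t : ℝ, -(τ₀ - t_b) * M ^ 2 < s → s < t → t ≤ 0 →
        let w : ℝ → EuclideanSpace ℝ (Fin 3) → EuclideanSpace ℝ (Fin 3) := M⁻¹ • stPull (M⁻¹ ^ 2) M⁻¹ τ₀ y₀ X.u
        let wt : ℝ → EuclideanSpace ℝ (Fin 3) → EuclideanSpace ℝ (Fin 3) := fun σ z => χ z • w σ z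
        ((∀ σ ∈ Icc (τ₀ + M⁻¹ ^ 2 * s) (τ₀ + M⁻¹ ^ 2 * t), ∀ z ∈ ball y₀ (R / M), ‖X.u σ z‖ ≤ Λ * M) → t - s ≤ 1 → ∀ z, ‖wt t z - UnboundedOperators.heatExtension (wt s) (t - s) z +
            oseenDuhamel 1 s wt wt t z‖ ≤ Λ ^ 2 * (P + Q * (1 / R + 1 / R ^ 2 + (1 + M) / R ^ 4 + M⁻¹)) * Real.sqrt (t - s)) ∧
        ((∀ z ∈ ball y₀ (R / M), ‖X.u (τ₀ + M⁻¹ ^ 2 * s) z‖ ≤ Λ * M) → ∀ z, ‖z‖ ≤ R / 4 → ‖wt t z - UnboundedOperators.heatExtension (wt s) (t - s) z +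
            oseenDuhamel 1 s wt wt t z‖ ≤ Λ ^ 2 * (Q * (1 / R + 1 / R ^ 2 + (1 + M) / R ^ 4 + M⁻¹)) * (Real.sqrt (t - s) + (t - s))) := by
  have hT := X.T_pos
  obtain ⟨E, hEt, hE⟩ := X.energy_le one_pos
  obtain ⟨Gf, hGf0, hres⟩ := X.norm_oseenResidual_le one_pos
  obtain ⟨C, hC, hB⟩ := exists_norm_oseenDuhamel_bounded_le (E := EuclideanSpace ℝ (Fin 3))
  set E' : ℝ := E.toReal with hE'; have hE'0 : 0 ≤ E' := ENNReal.toReal_nonneg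
  obtain ⟨D₁, D₂, hD₁, hD₂, hcommTool⟩ := exists_norm_heatCommutator_three_le
  obtain ⟨CK, hCK, hlocTool⟩ := exists_norm_oseenDuhamel_sub_le_of_eqOn_ball
  obtain ⟨P, hP⟩ : ∃ P : ℝ, P = 4 * C := ⟨_, rfl⟩
  obtain ⟨Q, hQ⟩ : ∃ Q : ℝ, Q = 4 * D₁ + 64 + D₂ * E' + 8192 * CK * E' + Gf := ⟨_, rfl⟩
  have hP0 : 0 ≤ P := (by rw [hP]; positivity); have hQ0 : 0 ≤ Q := (by rw [hQ]; positivity)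
  refine ⟨P, Q, hP0, hQ0, ?_⟩
  intro τ₀ t_b M R Λ y₀ χ hτ₀ htb0 htb hM hR hΛ4 hχ01 hχ1 hχ0 hχL hχc s t hs hst ht0 w wt
  have hM0 : 0 < M := lt_of_lt_of_le one_pos hM; have hc0 : 0 < M⁻¹ := inv_pos.2 hM0
  have hc1 : M⁻¹ ≤ 1 := inv_le_one_of_one_le₀ hM; have hcM : M⁻¹ * M = 1 := inv_mul_cancel₀ hM0.ne'
  have hΛ1 : 1 ≤ Λ := le_trans (by norm_num) hΛ4; have hΛ0 : 0 ≤ Λ := le_trans zero_le_one hΛ1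
  have hΛsq1 : 1 ≤ Λ ^ 2 := one_le_pow₀ hΛ1; have hΛsq0 : 0 ≤ Λ ^ 2 := sq_nonneg Λ
  have hΛleSq : Λ ≤ Λ ^ 2 := by nlinarith
  have hh : 0 < t - s := sub_pos.2 hst; have hsqrt0 : 0 < Real.sqrt (t - s) := Real.sqrt_pos.2 hh
  have hh_sqrt : t - s ≤ 1 → t - s ≤ Real.sqrt (t - s) := fun hlag => by
    rw [Real.le_sqrt hh.le hh.le]; nlinarith
  have hτ₀0 : 0 < τ₀ := lt_of_le_of_lt htb0 htb
  have hc2 : M⁻¹ ^ 2 * M ^ 2 = 1 := by rw [← mul_pow, hcM, one_pow]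
  have hphys : ∀ σ, -(τ₀ - t_b) * M ^ 2 < σ → σ ≤ 0 → τ₀ + M⁻¹ ^ 2 * σ ∈ Icc t_b τ₀ := by
    intro σ hσ hσ0
    constructor
    · have h1 : M⁻¹ ^ 2 * (-(τ₀ - t_b) * M ^ 2) < M⁻¹ ^ 2 * σ := mul_lt_mul_of_pos_left hσ (pow_pos hc0 2)
      have h2 : M⁻¹ ^ 2 * (-(τ₀ - t_b) * M ^ 2) = -(τ₀ - t_b) := by rw [show M⁻¹ ^ 2 * (-(τ₀ - t_b) * M ^ 2) = -(τ₀ - t_b) * (M⁻¹ ^ 2 * M ^ 2) by ring, hc2, mul_one]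
      linarith
    · nlinarith [pow_pos hc0 2]
  have hphysT : ∀ σ, -(τ₀ - t_b) * M ^ 2 < σ → σ ≤ 0 → τ₀ + M⁻¹ ^ 2 * σ ∈ Ico 0 X.T := fun σ hσ hσ0 => ⟨htb0.trans (hphys σ hσ hσ0).1, (hphys σ hσ hσ0).2.trans_lt hτ₀⟩
  have hw_def : w = M⁻¹ • stPull (M⁻¹ ^ 2) M⁻¹ τ₀ y₀ X.u := rfl
  have hwt_def : wt = fun σ z => χ z • w σ z := rfl
  clear_value wt w
  have hw_apply : ∀ σ z, w σ z = M⁻¹ • X.u (τ₀ + M⁻¹ ^ 2 * σ) (y₀ + M⁻¹ • z) := fun σ z => by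
    rw [hw_def]; rfl
  have hwt_apply : ∀ σ z, wt σ z = χ z • w σ z := fun σ z => by rw [hwt_def]
  obtain ⟨gz, qz, hclz⟩ : ∃ (gz : ℝ → EuclideanSpace ℝ (Fin 3) → EuclideanSpace ℝ (Fin 3))
      (qz : ℝ → EuclideanSpace ℝ (Fin 3) → ℝ), IsClassicalNSSolutionOn (Ioc (-(τ₀ - t_b) * M ^ 2) 0) 1 gz w qz := by
    have hcl := X.classical.nsRescale_translate hc0 τ₀ y₀
    rw [← hw_def] at hcl
    refine ⟨_, _, hcl.mono (fun σ hσ => ?_) (uniqueDiffOn_Ioc _ _)⟩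
    exact hphysT σ hσ.1 hσ.2
  have hwc : ContinuousOn (uncurry w) (Ioc (-(τ₀ - t_b) * M ^ 2) 0 ×ˢ univ) := hclz.smooth_velocity.continuousOn
  have hwslice : ∀ σ ∈ Ioc (-(τ₀ - t_b) * M ^ 2) 0, Continuous (w σ) := fun σ hσ => (hclz.contDiff_velocity hσ).continuous
  have hsub : Ioo s t ×ˢ (univ : Set (EuclideanSpace ℝ (Fin 3))) ⊆ Ioc (-(τ₀ - t_b) * M ^ 2) 0 ×ˢ univ := Set.prod_mono (fun σ hσ => ⟨hs.trans hσ.1, (hσ.2.trans_le ht0).le⟩) subset_rfl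
  have hwm : AEStronglyMeasurable (uncurry w)
      ((volume : Measure (ℝ × EuclideanSpace ℝ (Fin 3))).restrict (Ioo s t ×ˢ univ)) :=
    (hwc.mono hsub).aestronglyMeasurable (measurableSet_Ioo.prod MeasurableSet.univ)
  have hwtm : AEStronglyMeasurable (uncurry wt)
      ((volume : Measure (ℝ × EuclideanSpace ℝ (Fin 3))).restrict (Ioo s t ×ˢ univ)) := by
    have h0 : uncurry wt = fun p : ℝ × EuclideanSpace ℝ (Fin 3) => χ p.2 • uncurry w p := by funext p; rw [hwt_def]; rfl
    have h1 : ContinuousOn (fun p : ℝ × EuclideanSpace ℝ (Fin 3) => χ p.2 • uncurry w p)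
        (Ioo s t ×ˢ univ) := ((hχc.comp continuous_snd).continuousOn).smul (hwc.mono hsub)
    rw [h0]
    exact h1.aestronglyMeasurable (measurableSet_Ioo.prod MeasurableSet.univ)
  -- the ratio bound at a zoomed time `σ`, from the physical bound at `τ₀ + M⁻² σ`
  have hwΛ_of : ∀ σ, (∀ z ∈ ball y₀ (R / M), ‖X.u (τ₀ + M⁻¹ ^ 2 * σ) z‖ ≤ Λ * M) → ∀ z, ‖z‖ < R → ‖w σ z‖ ≤ Λ := by
    intro σ hσΛ z hz
    rw [hw_apply, norm_smul, Real.norm_of_nonneg hc0.le]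
    have hball : y₀ + M⁻¹ • z ∈ ball y₀ (R / M) := by
      rw [mem_ball, dist_eq_norm, add_sub_cancel_left, norm_smul, Real.norm_of_nonneg hc0.le, div_eq_inv_mul]
      exact mul_lt_mul_of_pos_left hz hc0
    have h := hσΛ _ hball
    calc M⁻¹ * ‖X.u (τ₀ + M⁻¹ ^ 2 * σ) (y₀ + M⁻¹ • z)‖ ≤ M⁻¹ * (Λ * M) := mul_le_mul_of_nonneg_left h hc0.le
      _ = Λ := by rw [← mul_assoc, mul_comm M⁻¹, mul_assoc, mul_comm M⁻¹]; rw [mul_inv_cancel₀ hM0.ne', mul_one]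
  obtain ⟨N, hN⟩ := X.exists_norm_le one_pos hτ₀
  set Nw : ℝ := max (M⁻¹ * N) Λ with hNw
  have hNwΛ : Λ ≤ Nw := le_max_right _ _; have hNw0 : 0 ≤ Nw := le_trans hΛ0 hNwΛ
  have hwN : ∀ σ, -(τ₀ - t_b) * M ^ 2 < σ → σ ≤ 0 → ∀ z, ‖w σ z‖ ≤ Nw := by
    intro σ hσ hσ0 z
    rw [hw_apply, norm_smul, Real.norm_of_nonneg hc0.le]
    have ht' := hphysT σ hσ hσ0
    exact (mul_le_mul_of_nonneg_left (hN _ ⟨ht'.1, (hphys σ hσ hσ0).2⟩ _) hc0.le).trans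
      (le_max_left _ _)
  have hχsupp : ∀ y, χ y ≠ 0 → ‖y‖ < R - R / 4 := by
    intro y hy; have : ¬ 3 * R / 4 ≤ ‖y‖ := fun h => hy (hχ0 y h); push Not at this; linarith
  -- truncated bound from the ratio bound at one zoomed time
  have hwtΛ_of : ∀ σ, (∀ z, ‖z‖ < R → ‖w σ z‖ ≤ Λ) → ∀ z, ‖wt σ z‖ ≤ Λ := by
    intro σ hσ z
    rw [hwt_apply, norm_smul, Real.norm_of_nonneg (hχ01 z).1]
    by_cases hz : χ z = 0
    · rw [hz, zero_mul]; exact hΛ0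
    · have hzR : ‖z‖ < R := (hχsupp z hz).trans (by linarith)
      calc χ z * ‖w σ z‖ ≤ 1 * Λ := mul_le_mul (hχ01 z).2 (hσ z hzR) (norm_nonneg _) zero_le_one
        _ = Λ := one_mul _
  have hwtN : ∀ σ, -(τ₀ - t_b) * M ^ 2 < σ → σ ≤ 0 → ∀ z, ‖wt σ z‖ ≤ Nw := by
    intro σ hσ hσ0 z
    rw [hwt_apply, norm_smul, Real.norm_of_nonneg (hχ01 z).1]
    calc χ z * ‖w σ z‖ ≤ 1 * ‖w σ z‖ := mul_le_mul_of_nonneg_right (hχ01 z).2 (norm_nonneg _)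
      _ ≤ Nw := by rw [one_mul]; exact hwN σ hσ hσ0 z
  have hEw : ∀ σ, -(τ₀ - t_b) * M ^ 2 < σ → σ ≤ 0 → ∫⁻ z, ‖w σ z‖ₑ ^ 2 ≤ ENNReal.ofReal M * E := by
    intro σ hσ hσ0
    have h := lintegral_zoom_slice_sq_le hM0 (τ₀ + M⁻¹ ^ 2 * σ) y₀ X.u (hE _ (hphysT σ hσ hσ0))
    simpa only [hw_apply] using h
  have hEwt : ∀ σ, -(τ₀ - t_b) * M ^ 2 < σ → σ ≤ 0 → ∫⁻ z, ‖wt σ z‖ₑ ^ 2 ≤ ENNReal.ofReal M * E := by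
    intro σ hσ hσ0
    refine (lintegral_mono fun z => ?_).trans (hEw σ hσ hσ0)
    have h1 : ‖wt σ z‖ₑ ≤ ‖w σ z‖ₑ := by
      rw [← ofReal_norm, ← ofReal_norm, hwt_apply, norm_smul, Real.norm_of_nonneg (hχ01 z).1]
      exact ENNReal.ofReal_le_ofReal (mul_le_of_le_one_left (norm_nonneg _) (hχ01 z).2)
    exact pow_le_pow_left' h1 2
  have hME : ENNReal.ofReal M * E ≠ ⊤ := ENNReal.mul_ne_top ENNReal.ofReal_ne_top hEt.ne
  have hMEreal : (ENNReal.ofReal M * E).toReal = M * E' := by rw [ENNReal.toReal_mul, ENNReal.toReal_ofReal hM0.le]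
  have hF : ∀ z, ‖w t z - UnboundedOperators.heatExtension (w s) (t - s) z + oseenDuhamel 1 s w w t z‖ ≤ M⁻¹ ^ 3 * (t - s) * Gf := by
    intro z
    have hs' := hphysT s hs (hst.le.trans ht0)
    have ht' := hphysT t (hs.trans hst) ht0
    have hss' : τ₀ + M⁻¹ ^ 2 * s < τ₀ + M⁻¹ ^ 2 * t := by nlinarith [pow_pos hc0 2]
    have key := norm_oseenResidual_smul_stPull_le hc0 τ₀ y₀ X.u hst z
      (hres _ _ hs'.1 hss' ht'.2 (y₀ + M⁻¹ • z))
    rwa [← hw_def] at key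
  have hc3 : M⁻¹ ^ 3 ≤ M⁻¹ := by have : M⁻¹ ^ 2 ≤ 1 := pow_le_one₀ hc0.le hc1; nlinarith
  have hFle' : ∀ z, ‖w t z - UnboundedOperators.heatExtension (w s) (t - s) z + oseenDuhamel 1 s w w t z‖ ≤ Gf * M⁻¹ * (t - s) := by
    intro z
    refine (hF z).trans ?_
    calc M⁻¹ ^ 3 * (t - s) * Gf ≤ M⁻¹ * (t - s) * Gf := by gcongr
      _ = Gf * M⁻¹ * (t - s) := by ring
  have hFle : t - s ≤ 1 → ∀ z, ‖w t z - UnboundedOperators.heatExtension (w s) (t - s) z + oseenDuhamel 1 s w w t z‖ ≤ Gf * M⁻¹ * Real.sqrt (t - s) := by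
    intro hlag z; exact (hFle' z).trans (mul_le_mul_of_nonneg_left (hh_sqrt hlag) (by positivity))
  -- the Duhamel term of fields bounded by `Λ`
  have hBΛ : ∀ {v : ℝ → EuclideanSpace ℝ (Fin 3) → EuclideanSpace ℝ (Fin 3)}, (∀ σ ∈ Ioo s t, ∀ y, ‖v σ y‖ ≤ Λ) → ∀ z, ‖oseenDuhamel 1 s v v t z‖ ≤ 2 * C * Λ ^ 2 * Real.sqrt (t - s) := by
    intro v hv z; have h := hB one_pos hst hΛ0 hv hv z; rw [Real.one_rpow] at h; linarith
  have hwN' : ∀ σ ∈ Ioo s t, ∀ y, ‖w σ y‖ ≤ Nw := fun σ hσ y => hwN σ (hs.trans hσ.1) (hσ.2.le.trans ht0) y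
  have hwtN' : ∀ σ ∈ Ioo s t, ∀ y, ‖wt σ y‖ ≤ Nw := fun σ hσ y => hwtN σ (hs.trans hσ.1) (hσ.2.le.trans ht0) y
  -- the heat commutator, given the ratio bound at the base time `s`
  have hcomm : (∀ z, ‖z‖ < R → ‖w s z‖ ≤ Λ) → ∀ z, ‖χ z • UnboundedOperators.heatExtension (w s) (t - s) z -
      UnboundedOperators.heatExtension (wt s) (t - s) z‖ ≤ (D₁ * Λ * (1 / R) + D₂ * E' * ((1 + M) / R ^ 4)) * Real.sqrt (t - s) + 64 * (1 / R ^ 2) * (t - s) := by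
    intro hwsΛ z
    have hs0 : s ≤ 0 := hst.le.trans ht0
    have hfc : Continuous (w s) := hwslice s ⟨hs, hs0⟩
    obtain ⟨hfi, hfE⟩ := integrable_sq_norm_of_lintegral_le hfc hME (hEw s hs hs0)
    rw [hMEreal] at hfE
    have key := hcommTool hh hR hΛ0 (by positivity : 0 ≤ M * E') hχ01 hχ0
      hχL hχc hfc (hwN s hs hs0) (fun y hy => hwsΛ y hy) hfi hfE z
    have hwts : (fun y => χ y • w s y) = wt s := funext fun y => (hwt_apply s y).symm
    rw [hwts] at key
    refine key.trans ?_
    have h1 : D₁ * Λ / R = D₁ * Λ * (1 / R) := by ring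
    have h2 : D₂ * (M * E') / R ^ 4 ≤ D₂ * E' * ((1 + M) / R ^ 4) := by
      rw [div_eq_mul_one_div]
      have h3 : M * E' ≤ E' * (1 + M) := by nlinarith only [hE'0, hM0]
      calc D₂ * (M * E') * (1 / R ^ 4) ≤ D₂ * (E' * (1 + M)) * (1 / R ^ 4) := by gcongr
        _ = D₂ * E' * ((1 + M) / R ^ 4) := by ring
    have h4 : 64 * (t - s) / R ^ 2 = 64 * (1 / R ^ 2) * (t - s) := by ring
    nlinarith only [h1, h2, h4, hsqrt0]
  have hlocal : ∀ {v v' : ℝ → EuclideanSpace ℝ (Fin 3) → EuclideanSpace ℝ (Fin 3)} (z : EuclideanSpace ℝ (Fin 3)),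
      AEStronglyMeasurable (uncurry v) ((volume : Measure (ℝ × EuclideanSpace ℝ (Fin 3))).restrict (Ioo s t ×ˢ univ)) →
      AEStronglyMeasurable (uncurry v') ((volume : Measure (ℝ × EuclideanSpace ℝ (Fin 3))).restrict (Ioo s t ×ˢ univ)) →
      (∀ σ ∈ Ioo s t, ∀ y, ‖v σ y‖ ≤ Nw) → (∀ σ ∈ Ioo s t, ∀ y, ‖v' σ y‖ ≤ Nw) → (∀ σ ∈ Ioo s t, ∀ y, y ∈ ball z (R / 4) → v' σ y = v σ y) →
      (∀ σ ∈ Ioo s t, ∫⁻ y, ‖v σ y‖ₑ ^ 2 ≤ ENNReal.ofReal M * E) → (∀ σ ∈ Ioo s t, ∫⁻ y, ‖v' σ y‖ₑ ^ 2 ≤ ENNReal.ofReal M * E) →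
      ‖oseenDuhamel 1 s v v t z - oseenDuhamel 1 s v' v' t z‖ ≤ 8192 * CK * E' * ((1 + M) / R ^ 4) * (t - s) := by
    intro v v' z hvm hv'm hvN hv'N hagree hEv hEv'
    have key := hlocTool z hst hNw0 hR hM0 hEt.ne hvm hv'm hvN hv'N hagree hEv hEv'
    refine key.trans ?_
    have h3 : M / R ^ 4 ≤ (1 + M) / R ^ 4 := div_le_div_of_nonneg_right (by linarith) (by positivity)
    gcongr
  have hdecomp : ∀ z, wt t z - UnboundedOperators.heatExtension (wt s) (t - s) z + oseenDuhamel 1 s wt wt t z = (χ z • UnboundedOperators.heatExtension (w s) (t - s) z -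
        UnboundedOperators.heatExtension (wt s) (t - s) z) +
      (oseenDuhamel 1 s wt wt t z - χ z • oseenDuhamel 1 s w w t z) +
      χ z • (w t z - UnboundedOperators.heatExtension (w s) (t - s) z + oseenDuhamel 1 s w w t z) := by
    intro z
    rw [hwt_apply t z, smul_add, smul_sub]
    abel
  -- the `Θ`-collection, without and with the ratio factor
  have hQdom : 4 * D₁ * (1 / R) + 64 * (1 / R ^ 2) + (D₂ * E' + 8192 * CK * E') * ((1 + M) / R ^ 4) + Gf * M⁻¹ ≤ Q * (1 / R + 1 / R ^ 2 + (1 + M) / R ^ 4 + M⁻¹) := by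
    have h1 : 0 ≤ 1 / R := by positivity
    have h1' : 0 ≤ 1 / R ^ 2 := by positivity
    have h2 : 0 ≤ (1 + M) / R ^ 4 := by positivity
    have h3 : 0 ≤ M⁻¹ := hc0.le
    have hq1 : 4 * D₁ ≤ Q := by rw [hQ]; nlinarith only [hD₂, hE'0, hCK.le, hGf0]
    have hq1' : (64 : ℝ) ≤ Q := by rw [hQ]; nlinarith only [hD₁, hD₂, hE'0, hCK.le, hGf0]
    have hq2 : D₂ * E' + 8192 * CK * E' ≤ Q := by rw [hQ]; nlinarith only [hD₁, hGf0]
    have hq3 : Gf ≤ Q := by rw [hQ]; nlinarith only [hD₁, hD₂, hE'0, hCK.le]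
    calc 4 * D₁ * (1 / R) + 64 * (1 / R ^ 2) + (D₂ * E' + 8192 * CK * E') * ((1 + M) / R ^ 4) + Gf * M⁻¹
        ≤ Q * (1 / R) + Q * (1 / R ^ 2) + Q * ((1 + M) / R ^ 4) + Q * M⁻¹ := add_le_add (add_le_add (add_le_add (mul_le_mul_of_nonneg_right hq1 h1)
            (mul_le_mul_of_nonneg_right hq1' h1')) (mul_le_mul_of_nonneg_right hq2 h2))
            (mul_le_mul_of_nonneg_right hq3 h3)
      _ = Q * (1 / R + 1 / R ^ 2 + (1 + M) / R ^ 4 + M⁻¹) := by ring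
  have hΘ0 : 0 ≤ 1 / R + 1 / R ^ 2 + (1 + M) / R ^ 4 + M⁻¹ := by positivity
  -- every individual coefficient is dominated by `Λ²` times its ratio-free form
  have hcoef1 : D₁ * Λ * (1 / R) ≤ Λ ^ 2 * (4 * D₁ * (1 / R)) := by
    have h0 : 0 ≤ D₁ * (1 / R) := by positivity
    calc D₁ * Λ * (1 / R) = Λ * (D₁ * (1 / R)) := by ring
      _ ≤ Λ ^ 2 * (D₁ * (1 / R)) := mul_le_mul_of_nonneg_right hΛleSq h0
      _ ≤ Λ ^ 2 * (4 * D₁ * (1 / R)) := mul_le_mul_of_nonneg_left (by nlinarith [h0]) hΛsq0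
  have hcoef2 : D₂ * E' * ((1 + M) / R ^ 4) ≤ Λ ^ 2 * (D₂ * E' * ((1 + M) / R ^ 4)) := le_mul_of_one_le_left (by positivity) hΛsq1
  have hcoef3 : 64 * (1 / R ^ 2) ≤ Λ ^ 2 * (64 * (1 / R ^ 2)) := le_mul_of_one_le_left (by positivity) hΛsq1
  have hcoef4 : 8192 * CK * E' * ((1 + M) / R ^ 4) ≤ Λ ^ 2 * (8192 * CK * E' * ((1 + M) / R ^ 4)) := le_mul_of_one_le_left (by positivity) hΛsq1
  have hcoef5 : Gf * M⁻¹ ≤ Λ ^ 2 * (Gf * M⁻¹) := le_mul_of_one_le_left (by positivity) hΛsq1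
  refine ⟨fun hΛwin hlag z => ?_, fun hΛbase z hz => ?_⟩
  · -- ### (i) the uniform bound on the window
    have hphys_s := hphys s hs (hst.le.trans ht0)
    have hwΛ : ∀ σ, s ≤ σ → σ ≤ t → ∀ z, ‖z‖ < R → ‖w σ z‖ ≤ Λ := by
      intro σ hsσ hσt z hz
      refine hwΛ_of σ (fun y hy => hΛwin _ ⟨?_, ?_⟩ y hy) z hz
      · linarith [mul_le_mul_of_nonneg_left hsσ (pow_pos hc0 2).le]
      · linarith [mul_le_mul_of_nonneg_left hσt (pow_pos hc0 2).le]
    have hwsΛ : ∀ z, ‖z‖ < R → ‖w s z‖ ≤ Λ := hwΛ s le_rfl hst.le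
    have hwtΛ' : ∀ σ ∈ Ioo s t, ∀ y, ‖wt σ y‖ ≤ Λ := fun σ hσ y => hwtΛ_of σ (hwΛ σ hσ.1.le hσ.2.le) y
    rw [hdecomp z]
    set wb : ℝ → EuclideanSpace ℝ (Fin 3) → EuclideanSpace ℝ (Fin 3) := fun σ y => (univ ×ˢ ball (0 : EuclideanSpace ℝ (Fin 3)) R).indicator (uncurry w) (σ, y) with hwb
    have hwb_in : ∀ σ y, y ∈ ball (0 : EuclideanSpace ℝ (Fin 3)) R → wb σ y = w σ y := fun σ y hy => by
      simp only [hwb, indicator_of_mem (show (σ, y) ∈ univ ×ˢ ball (0 : EuclideanSpace ℝ (Fin 3)) R from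
        ⟨mem_univ _, hy⟩), uncurry_apply_pair]
    have hwb_out : ∀ σ y, y ∉ ball (0 : EuclideanSpace ℝ (Fin 3)) R → wb σ y = 0 := fun σ y hy => by
      simp only [hwb, indicator_of_notMem (show (σ, y) ∉ univ ×ˢ ball (0 : EuclideanSpace ℝ (Fin 3)) R from
        fun h => hy h.2)]
    have hwbΛ : ∀ σ ∈ Ioo s t, ∀ y, ‖wb σ y‖ ≤ Λ := by
      intro σ hσ y
      by_cases hy : y ∈ ball (0 : EuclideanSpace ℝ (Fin 3)) R
      · rw [hwb_in σ y hy]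
        exact hwΛ σ hσ.1.le hσ.2.le y (mem_ball_zero_iff.1 hy)
      · rw [hwb_out σ y hy, norm_zero]; exact hΛ0
    have hwbN : ∀ σ ∈ Ioo s t, ∀ y, ‖wb σ y‖ ≤ Nw := fun σ hσ y => (hwbΛ σ hσ y).trans hNwΛ
    have hwbm : AEStronglyMeasurable (uncurry wb)
        ((volume : Measure (ℝ × EuclideanSpace ℝ (Fin 3))).restrict (Ioo s t ×ˢ univ)) :=
      (hwm.indicator (MeasurableSet.univ.prod measurableSet_ball :
        MeasurableSet (univ ×ˢ ball (0 : EuclideanSpace ℝ (Fin 3)) R))).congr (Eventually.of_forall fun p => rfl)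
    have hEwb : ∀ σ ∈ Ioo s t, ∫⁻ y, ‖wb σ y‖ₑ ^ 2 ≤ ENNReal.ofReal M * E := by
      intro σ hσ
      refine (lintegral_mono fun y => ?_).trans (hEw σ (hs.trans hσ.1) (hσ.2.le.trans ht0))
      have h1 : ‖wb σ y‖ₑ ≤ ‖w σ y‖ₑ := by
        rw [← ofReal_norm, ← ofReal_norm]
        refine ENNReal.ofReal_le_ofReal ?_
        by_cases hy : y ∈ ball (0 : EuclideanSpace ℝ (Fin 3)) R
        · rw [hwb_in σ y hy]
        · rw [hwb_out σ y hy, norm_zero]; exact norm_nonneg _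
      exact pow_le_pow_left' h1 2
    have hχB : ‖χ z • oseenDuhamel 1 s w w t z‖ ≤ (2 * C * Λ ^ 2 + 8192 * CK * E' * ((1 + M) / R ^ 4)) * Real.sqrt (t - s) := by
      by_cases hχz : χ z = 0
      · rw [hχz, zero_smul, norm_zero]; positivity
      · have hzR : ‖z‖ < 3 * R / 4 := by
          have : ¬ 3 * R / 4 ≤ ‖z‖ := fun h' => hχz (hχ0 z h'); push Not at this; exact this
        rw [norm_smul, Real.norm_of_nonneg (hχ01 z).1]
        have hdiff := hlocal z hwm hwbm hwN' hwbN (fun σ hσ y hy => hwb_in σ y (by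
            rw [mem_ball_zero_iff]
            calc ‖y‖ ≤ ‖y - z‖ + ‖z‖ := norm_le_norm_sub_add y z
              _ < R / 4 + 3 * R / 4 := add_lt_add (by rwa [← dist_eq_norm, ← mem_ball]) hzR
              _ = R := by ring))
          (fun σ hσ => hEw σ (hs.trans hσ.1) (hσ.2.le.trans ht0)) hEwb
        have h1 : ‖oseenDuhamel 1 s w w t z‖ ≤ ‖oseenDuhamel 1 s w w t z - oseenDuhamel 1 s wb wb t z‖ + ‖oseenDuhamel 1 s wb wb t z‖ := norm_le_norm_sub_add _ _
        have hdiff' : ‖oseenDuhamel 1 s w w t z - oseenDuhamel 1 s wb wb t z‖ ≤ 8192 * CK * E' * ((1 + M) / R ^ 4) * Real.sqrt (t - s) := by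
          exact hdiff.trans (mul_le_mul_of_nonneg_left (hh_sqrt hlag) (by positivity))
        calc χ z * ‖oseenDuhamel 1 s w w t z‖ ≤ 1 * ‖oseenDuhamel 1 s w w t z‖ := mul_le_mul_of_nonneg_right (hχ01 z).2 (norm_nonneg _)
          _ ≤ 8192 * CK * E' * ((1 + M) / R ^ 4) * Real.sqrt (t - s) + 2 * C * Λ ^ 2 * Real.sqrt (t - s) := by rw [one_mul]; exact h1.trans (add_le_add hdiff' (hBΛ hwbΛ z))
          _ = _ := by ring
    have hBt : ‖oseenDuhamel 1 s wt wt t z‖ ≤ 2 * C * Λ ^ 2 * Real.sqrt (t - s) := hBΛ hwtΛ' z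
    have hχF : ‖χ z • (w t z - UnboundedOperators.heatExtension (w s) (t - s) z + oseenDuhamel 1 s w w t z)‖ ≤ Gf * M⁻¹ * Real.sqrt (t - s) := by
      rw [norm_smul, Real.norm_of_nonneg (hχ01 z).1]
      calc χ z * _ ≤ 1 * _ := mul_le_mul (hχ01 z).2 (hFle hlag z) (norm_nonneg _) zero_le_one
        _ = _ := one_mul _
    have hcommz : ‖χ z • UnboundedOperators.heatExtension (w s) (t - s) z -
        UnboundedOperators.heatExtension (wt s) (t - s) z‖ ≤ (D₁ * Λ * (1 / R) + 64 * (1 / R ^ 2) + D₂ * E' * ((1 + M) / R ^ 4)) * Real.sqrt (t - s) := by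
      refine (hcomm hwsΛ z).trans ?_
      have h0 : (0 : ℝ) ≤ 64 * (1 / R ^ 2) := by positivity
      have h1 := mul_le_mul_of_nonneg_left (hh_sqrt hlag) h0
      linarith [h1]
    have hsum : (D₁ * Λ * (1 / R) + 64 * (1 / R ^ 2) + D₂ * E' * ((1 + M) / R ^ 4)) + (2 * C * Λ ^ 2 + (2 * C * Λ ^ 2 + 8192 * CK * E' * ((1 + M) / R ^ 4))) + Gf * M⁻¹ ≤
        Λ ^ 2 * (P + Q * (1 / R + 1 / R ^ 2 + (1 + M) / R ^ 4 + M⁻¹)) := by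
      have hPΛ : 2 * C * Λ ^ 2 + 2 * C * Λ ^ 2 = Λ ^ 2 * P := by rw [hP]; ring
      have hrest : D₁ * Λ * (1 / R) + 64 * (1 / R ^ 2) + D₂ * E' * ((1 + M) / R ^ 4) + 8192 * CK * E' * ((1 + M) / R ^ 4) + Gf * M⁻¹ ≤
          Λ ^ 2 * (4 * D₁ * (1 / R) + 64 * (1 / R ^ 2) + (D₂ * E' + 8192 * CK * E') * ((1 + M) / R ^ 4) + Gf * M⁻¹) := by linarith [hcoef1, hcoef2, hcoef3, hcoef4, hcoef5]
      have hQΛ : Λ ^ 2 * (4 * D₁ * (1 / R) + 64 * (1 / R ^ 2) + (D₂ * E' + 8192 * CK * E') * ((1 + M) / R ^ 4) + Gf * M⁻¹) ≤ Λ ^ 2 * (Q * (1 / R + 1 / R ^ 2 + (1 + M) / R ^ 4 + M⁻¹)) :=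
        mul_le_mul_of_nonneg_left hQdom hΛsq0
      linarith [hPΛ, hrest, hQΛ]
    calc ‖(χ z • UnboundedOperators.heatExtension (w s) (t - s) z -
            UnboundedOperators.heatExtension (wt s) (t - s) z) +
          (oseenDuhamel 1 s wt wt t z - χ z • oseenDuhamel 1 s w w t z) +
          χ z • (w t z - UnboundedOperators.heatExtension (w s) (t - s) z + oseenDuhamel 1 s w w t z)‖
        ≤ ‖χ z • UnboundedOperators.heatExtension (w s) (t - s) z -
            UnboundedOperators.heatExtension (wt s) (t - s) z‖ +
          (‖oseenDuhamel 1 s wt wt t z‖ + ‖χ z • oseenDuhamel 1 s w w t z‖) +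
          ‖χ z • (w t z - UnboundedOperators.heatExtension (w s) (t - s) z + oseenDuhamel 1 s w w t z)‖ :=
          (norm_add_le _ _).trans (add_le_add ((norm_add_le _ _).trans (add_le_add le_rfl
            (norm_sub_le _ _))) le_rfl)
      _ ≤ (D₁ * Λ * (1 / R) + 64 * (1 / R ^ 2) + D₂ * E' * ((1 + M) / R ^ 4)) * Real.sqrt (t - s) +
          (2 * C * Λ ^ 2 * Real.sqrt (t - s) + (2 * C * Λ ^ 2 + 8192 * CK * E' * ((1 + M) / R ^ 4)) * Real.sqrt (t - s)) +
          Gf * M⁻¹ * Real.sqrt (t - s) := add_le_add (add_le_add hcommz (add_le_add hBt hχB)) hχF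
      _ = ((D₁ * Λ * (1 / R) + 64 * (1 / R ^ 2) + D₂ * E' * ((1 + M) / R ^ 4)) + (2 * C * Λ ^ 2 + (2 * C * Λ ^ 2 + 8192 * CK * E' * ((1 + M) / R ^ 4))) + Gf * M⁻¹) * Real.sqrt (t - s) := by ring
      _ ≤ Λ ^ 2 * (P + Q * (1 / R + 1 / R ^ 2 + (1 + M) / R ^ 4 + M⁻¹)) * Real.sqrt (t - s) := mul_le_mul_of_nonneg_right hsum (Real.sqrt_nonneg _)
  · -- ### (ii) the small bound on `B̄(0, R/4)`, from the ratio bound at the base time only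
    have hwsΛ : ∀ z, ‖z‖ < R → ‖w s z‖ ≤ Λ := hwΛ_of s hΛbase
    rw [hdecomp z]
    have hχz : χ z = 1 := hχ1 z (hz.trans (by linarith))
    simp only [hχz, one_smul]
    have hdiff := hlocal z hwm hwtm hwN' hwtN' (fun σ hσ y hy => by
        rw [hwt_apply, hχ1 y ?_, one_smul]
        calc ‖y‖ ≤ ‖y - z‖ + ‖z‖ := norm_le_norm_sub_add y z
          _ ≤ R / 4 + R / 4 := add_le_add (by rw [← dist_eq_norm]; exact (mem_ball.1 hy).le) hz
          _ = R / 2 := by ring)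
      (fun σ hσ => hEw σ (hs.trans hσ.1) (hσ.2.le.trans ht0))
      (fun σ hσ => hEwt σ (hs.trans hσ.1) (hσ.2.le.trans ht0))
    rw [norm_sub_rev] at hdiff
    have hcommz := hcomm hwsΛ z
    rw [hχz, one_smul] at hcommz
    have hsum : (D₁ * Λ * (1 / R) + D₂ * E' * ((1 + M) / R ^ 4)) * Real.sqrt (t - s) + 64 * (1 / R ^ 2) * (t - s) + 8192 * CK * E' * ((1 + M) / R ^ 4) * (t - s) +
        Gf * M⁻¹ * (t - s) ≤ Λ ^ 2 * (Q * (1 / R + 1 / R ^ 2 + (1 + M) / R ^ 4 + M⁻¹)) * (Real.sqrt (t - s) + (t - s)) := by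
      have hl0 : 0 ≤ t - s := hh.le
      have hs0' : 0 ≤ Real.sqrt (t - s) := Real.sqrt_nonneg _
      have hA1 : 0 ≤ D₁ * Λ * (1 / R) := by positivity
      have hA2 : 0 ≤ 64 * (1 / R ^ 2) := by positivity
      have hA3 : 0 ≤ D₂ * E' * ((1 + M) / R ^ 4) := by positivity
      have hA4 : 0 ≤ 8192 * CK * E' * ((1 + M) / R ^ 4) := by positivity
      have hA5 : 0 ≤ Gf * M⁻¹ := by positivity
      have hrest : D₁ * Λ * (1 / R) + 64 * (1 / R ^ 2) + D₂ * E' * ((1 + M) / R ^ 4) + 8192 * CK * E' * ((1 + M) / R ^ 4) + Gf * M⁻¹ ≤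
          Λ ^ 2 * (4 * D₁ * (1 / R) + 64 * (1 / R ^ 2) + (D₂ * E' + 8192 * CK * E') * ((1 + M) / R ^ 4) + Gf * M⁻¹) := by linarith [hcoef1, hcoef2, hcoef3, hcoef4, hcoef5]
      have hQΛ : Λ ^ 2 * (4 * D₁ * (1 / R) + 64 * (1 / R ^ 2) + (D₂ * E' + 8192 * CK * E') * ((1 + M) / R ^ 4) + Gf * M⁻¹) ≤ Λ ^ 2 * (Q * (1 / R + 1 / R ^ 2 + (1 + M) / R ^ 4 + M⁻¹)) :=
        mul_le_mul_of_nonneg_left hQdom hΛsq0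
      have htot : D₁ * Λ * (1 / R) + 64 * (1 / R ^ 2) + D₂ * E' * ((1 + M) / R ^ 4) + 8192 * CK * E' * ((1 + M) / R ^ 4) + Gf * M⁻¹ ≤
          Λ ^ 2 * (Q * (1 / R + 1 / R ^ 2 + (1 + M) / R ^ 4 + M⁻¹)) := hrest.trans hQΛ
      calc (D₁ * Λ * (1 / R) + D₂ * E' * ((1 + M) / R ^ 4)) * Real.sqrt (t - s) + 64 * (1 / R ^ 2) * (t - s) + 8192 * CK * E' * ((1 + M) / R ^ 4) * (t - s) + Gf * M⁻¹ * (t - s)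
          ≤ (D₁ * Λ * (1 / R) + 64 * (1 / R ^ 2) + D₂ * E' * ((1 + M) / R ^ 4) + 8192 * CK * E' * ((1 + M) / R ^ 4) + Gf * M⁻¹) * (Real.sqrt (t - s) + (t - s)) := by
            have hid : (D₁ * Λ * (1 / R) + 64 * (1 / R ^ 2) + D₂ * E' * ((1 + M) / R ^ 4) + 8192 * CK * E' * ((1 + M) / R ^ 4) + Gf * M⁻¹) * (Real.sqrt (t - s) + (t - s)) =
                ((D₁ * Λ * (1 / R) + D₂ * E' * ((1 + M) / R ^ 4)) * Real.sqrt (t - s) + 64 * (1 / R ^ 2) * (t - s) + 8192 * CK * E' * ((1 + M) / R ^ 4) * (t - s) + Gf * M⁻¹ * (t - s)) +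
                (D₁ * Λ * (1 / R) * (t - s) + 64 * (1 / R ^ 2) * Real.sqrt (t - s) + D₂ * E' * ((1 + M) / R ^ 4) * (t - s) +
                  8192 * CK * E' * ((1 + M) / R ^ 4) * Real.sqrt (t - s) + Gf * M⁻¹ * Real.sqrt (t - s)) := by
              ring
            rw [hid]
            linarith [mul_nonneg hA1 hl0, mul_nonneg hA2 hs0', mul_nonneg hA3 hl0, mul_nonneg hA4 hs0', mul_nonneg hA5 hs0']
        _ ≤ Λ ^ 2 * (Q * (1 / R + 1 / R ^ 2 + (1 + M) / R ^ 4 + M⁻¹)) * (Real.sqrt (t - s) + (t - s)) := mul_le_mul_of_nonneg_right htot (by positivity)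
    calc ‖(UnboundedOperators.heatExtension (w s) (t - s) z -
            UnboundedOperators.heatExtension (wt s) (t - s) z) +
          (oseenDuhamel 1 s wt wt t z - oseenDuhamel 1 s w w t z) +
          (w t z - UnboundedOperators.heatExtension (w s) (t - s) z + oseenDuhamel 1 s w w t z)‖
        ≤ ‖UnboundedOperators.heatExtension (w s) (t - s) z -
            UnboundedOperators.heatExtension (wt s) (t - s) z‖ +
          ‖oseenDuhamel 1 s wt wt t z - oseenDuhamel 1 s w w t z‖ +
          ‖w t z - UnboundedOperators.heatExtension (w s) (t - s) z + oseenDuhamel 1 s w w t z‖ := norm_add₃_le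
      _ ≤ ((D₁ * Λ * (1 / R) + D₂ * E' * ((1 + M) / R ^ 4)) * Real.sqrt (t - s) + 64 * (1 / R ^ 2) * (t - s)) + 8192 * CK * E' * ((1 + M) / R ^ 4) * (t - s) +
          Gf * M⁻¹ * (t - s) := add_le_add (add_le_add hcommz hdiff) (hFle' z)
      _ ≤ Λ ^ 2 * (Q * (1 / R + 1 / R ^ 2 + (1 + M) / R ^ 4 + M⁻¹)) * (Real.sqrt (t - s) + (t - s)) := by linarith only [hsum]
end ClayBlowup
end Summit.NavierStokesRegularity.FluidComputer
end
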